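import Summits.Langlands.Langlands.Theses.GoldenFieldSerre

/-!
# Birth skeleton (BC3) for crux `LevelOneModThreeGolden` of route `GoldenFieldSerre`

Crux (item stmt-Langlands-17047, route-Langlands-GoldenFieldSerre, rank 2):
every continuous irreducible totally odd `ρ̄ : Γ_F → GL₂(k)`, `F = ℚ(√5)` (typed: quadratic with a
square root of 5), `k` algebraically closed of characteristic 3 (discrete), unramified outside 3,
has SOLVABLE image.

Line (Tate–Serre–Moon–Taguchi shape, the route header's TWO-LAYER PLAN with the image bound put at
its group-theoretic threshold `19656 = |SL₂(𝔽₂₇)|`):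

* `stub_imageBound` (ImageBoundGolden; analytic / local-at-3): under the crux hypotheses the image
  has order `< 19656`.  Engine: Moon–Taguchi-type 3-adic different bounds over `ℚ₉` per tame
  signature (`rd(L) ≤ √5 · 3^(5/2) ≈ 34.9` in the worst corner, `≤ 11.6` finite flat), Odlyzko–Poitou
  (GRH: asymptotic 44.7; unconditional only in the low-weight regime) and the Schoof-type discharge
  of the high-weight corner.  Why it might fail: unconditionally the worst corner is beyond every
  Odlyzko table; the stub is the hardest one.
* `stub_dicksonSmall` (pure finite group theory, characteristic 3): a finite INSOLUBLE subgroup of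
  `GL₂(k)` of order `< 19656` is, up to conjugation, contained in `kˣ · GL₂(𝔽₉)` (Dickson: the
  insoluble finite subgroups of `PGL₂(k)` are `A₅`, `PSL₂(3^f)`, `PGL₂(3^f)`, `f ≥ 2`; below
  `|SL₂(𝔽₂₇)|` only the `𝔽₉`-family `2.A₅ ⊂ SL₂(𝔽₉)`, `SL₂(𝔽₉)`, `PGL₂(𝔽₉)`-type survives, since a
  centreless group with a Klein four-subgroup does not embed in `GL₂` in odd characteristic).
  `𝔽₉ ⊂ k` is written as `{a | a ^ 9 = a}`.
* `stub_f9SectorSolvable` (SmallImageSolvableGolden, the `𝔽₉`-sector; arithmetic / certified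
  enumeration): under the crux hypotheses an image conjugate into `kˣ · GL₂(𝔽₉)` is solvable, i.e.
  there is no odd level-one mod-3 representation of `Γ_{ℚ(√5)}` of type `2.A₅`, `SL₂(𝔽₉)` or
  `PGL₂(𝔽₉)` (targeted Hunter / Jones–Roberts searches over `ℚ(√5)` for relative `A₅`/`A₆`/`S₆`
  fields ramified only at `(3)`; or Ellenberg-type modularity of `GL₂(𝔽₉)`-representations plus the
  level-`(1),(3),(9)` Hilbert newform census over `ℚ(√5)`).

`LevelOneModThreeGolden_of_stubs` (stub statements as hypotheses, conclusion = the crux body verbatim)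
is a real proof: finiteness of the image (compact `Γ_F`, discrete `GL₂(k)`), then contraposition
through the three stubs; `LevelOneModThreeGolden_of : LevelOneModThreeGolden` applies it to the three
named stubs (registrar shape).  Sorries live ONLY in the three `stub_*`.
-/

namespace Summit.Langlands.Langlands.Cruxes.LevelOneModThreeGolden.Birth

open Literature.NumberTheory.GaloisRepresentations

/-- STUB (ImageBoundGolden, hardest): under the crux hypotheses the image of `ρ̄` has order
`< 19656 = |SL₂(𝔽₂₇)|`. -/
theorem stub_imageBound :
    ∀ (F : Type) [Field F] [NumberField F], Module.finrank ℚ F = 2 → (∃ a : F, a ^ 2 = 5) →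
    ∀ (k : Type) [Field k] [CharP k 3] [IsAlgClosed k] [TopologicalSpace k] [DiscreteTopology k],
    ∀ ρ : FramedGaloisRep F k 2, FramedRep.IsIrreducible ρ → ρ.IsOdd →
    (∀ v : IsDedekindDomain.HeightOneSpectrum (NumberField.RingOfIntegers F),
      ((3 : ℕ) : NumberField.RingOfIntegers F) ∉ v.asIdeal → ρ.IsUnramifiedAt v) →
    Nat.card ρ.toMonoidHom.range < 19656 := by
  sorry

/-- STUB (Dickson-lite, pure group theory in characteristic 3): a finite insoluble subgroup of
`GL₂(k)` of order `< 19656` is conjugate into `kˣ · GL₂(𝔽₉)`. -/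
theorem stub_dicksonSmall :
    ∀ (k : Type) [Field k] [CharP k 3] [IsAlgClosed k] (G : Subgroup (GL (Fin 2) k)),
    Finite G → Nat.card G < 19656 → ¬ IsSolvable G →
    ∃ g : GL (Fin 2) k, ∀ x ∈ G, ∃ c : k, c ≠ 0 ∧ ∀ i j : Fin 2,
      (c * ((g * x * g⁻¹ : GL (Fin 2) k) : Matrix (Fin 2) (Fin 2) k) i j) ^ 9
        = c * ((g * x * g⁻¹ : GL (Fin 2) k) : Matrix (Fin 2) (Fin 2) k) i j := by
  sorry

/-- STUB (SmallImageSolvableGolden / the `𝔽₉`-sector): under the crux hypotheses an image conjugate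
into `kˣ · GL₂(𝔽₉)` is solvable (no `2.A₅`, `SL₂(𝔽₉)`, `PGL₂(𝔽₉)`-type level-one odd mod-3
representation of `Γ_{ℚ(√5)}`). -/
theorem stub_f9SectorSolvable :
    ∀ (F : Type) [Field F] [NumberField F], Module.finrank ℚ F = 2 → (∃ a : F, a ^ 2 = 5) →
    ∀ (k : Type) [Field k] [CharP k 3] [IsAlgClosed k] [TopologicalSpace k] [DiscreteTopology k],
    ∀ ρ : FramedGaloisRep F k 2, FramedRep.IsIrreducible ρ → ρ.IsOdd →
    (∀ v : IsDedekindDomain.HeightOneSpectrum (NumberField.RingOfIntegers F),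
      ((3 : ℕ) : NumberField.RingOfIntegers F) ∉ v.asIdeal → ρ.IsUnramifiedAt v) →
    (∃ g : GL (Fin 2) k, ∀ x ∈ ρ.toMonoidHom.range, ∃ c : k, c ≠ 0 ∧ ∀ i j : Fin 2,
      (c * ((g * x * g⁻¹ : GL (Fin 2) k) : Matrix (Fin 2) (Fin 2) k) i j) ^ 9
        = c * ((g * x * g⁻¹ : GL (Fin 2) k) : Matrix (Fin 2) (Fin 2) k) i j) →
    IsSolvable ρ.toMonoidHom.range := by
  sorry

/-- ASSEMBLY, hypothetical form (real proof, no `sorry`): the three stub STATEMENTS imply the crux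
statement (verbatim the body of `Summit.Langlands.Langlands.Theses.GoldenFieldSerre.LevelOneModThreeGolden`):
the image of the compact `Γ_F` in the discrete `GL₂(k)` is finite; if it were insoluble, the image
bound and Dickson-lite would put it in the `𝔽₉`-sector, which is solvable — contradiction. -/
theorem LevelOneModThreeGolden_of_stubs
    (hBound : ∀ (F : Type) [Field F] [NumberField F], Module.finrank ℚ F = 2 → (∃ a : F, a ^ 2 = 5) →
      ∀ (k : Type) [Field k] [CharP k 3] [IsAlgClosed k] [TopologicalSpace k] [DiscreteTopology k],
      ∀ ρ : FramedGaloisRep F k 2, FramedRep.IsIrreducible ρ → ρ.IsOdd →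
      (∀ v : IsDedekindDomain.HeightOneSpectrum (NumberField.RingOfIntegers F),
        ((3 : ℕ) : NumberField.RingOfIntegers F) ∉ v.asIdeal → ρ.IsUnramifiedAt v) →
      Nat.card ρ.toMonoidHom.range < 19656)
    (hDickson : ∀ (k : Type) [Field k] [CharP k 3] [IsAlgClosed k] (G : Subgroup (GL (Fin 2) k)),
      Finite G → Nat.card G < 19656 → ¬ IsSolvable G →
      ∃ g : GL (Fin 2) k, ∀ x ∈ G, ∃ c : k, c ≠ 0 ∧ ∀ i j : Fin 2,
        (c * ((g * x * g⁻¹ : GL (Fin 2) k) : Matrix (Fin 2) (Fin 2) k) i j) ^ 9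
          = c * ((g * x * g⁻¹ : GL (Fin 2) k) : Matrix (Fin 2) (Fin 2) k) i j)
    (hF9 : ∀ (F : Type) [Field F] [NumberField F], Module.finrank ℚ F = 2 → (∃ a : F, a ^ 2 = 5) →
      ∀ (k : Type) [Field k] [CharP k 3] [IsAlgClosed k] [TopologicalSpace k] [DiscreteTopology k],
      ∀ ρ : FramedGaloisRep F k 2, FramedRep.IsIrreducible ρ → ρ.IsOdd →
      (∀ v : IsDedekindDomain.HeightOneSpectrum (NumberField.RingOfIntegers F),
        ((3 : ℕ) : NumberField.RingOfIntegers F) ∉ v.asIdeal → ρ.IsUnramifiedAt v) →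
      (∃ g : GL (Fin 2) k, ∀ x ∈ ρ.toMonoidHom.range, ∃ c : k, c ≠ 0 ∧ ∀ i j : Fin 2,
        (c * ((g * x * g⁻¹ : GL (Fin 2) k) : Matrix (Fin 2) (Fin 2) k) i j) ^ 9
          = c * ((g * x * g⁻¹ : GL (Fin 2) k) : Matrix (Fin 2) (Fin 2) k) i j) →
      IsSolvable ρ.toMonoidHom.range) :
    ∀ (F : Type) [Field F] [NumberField F], Module.finrank ℚ F = 2 → (∃ a : F, a ^ 2 = 5) →
      ∀ (k : Type) [Field k] [CharP k 3] [IsAlgClosed k] [TopologicalSpace k] [DiscreteTopology k],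
      ∀ ρ : Literature.NumberTheory.GaloisRepresentations.FramedGaloisRep F k 2,
      Literature.NumberTheory.GaloisRepresentations.FramedRep.IsIrreducible ρ → ρ.IsOdd →
      (∀ v : IsDedekindDomain.HeightOneSpectrum (NumberField.RingOfIntegers F),
        ((3 : ℕ) : NumberField.RingOfIntegers F) ∉ v.asIdeal → ρ.IsUnramifiedAt v) →
      IsSolvable ρ.toMonoidHom.range := by
  intro F _ _ hF h5 k _ _ _ _ _ ρ hirr hodd hur
  by_contra hns
  -- the image of the compact group `Γ_F` in the discrete group `GL₂(k)` is finite
  have hfin : Finite ρ.toMonoidHom.range := by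
    have hc : IsCompact (Set.range (fun σ => ρ σ)) := isCompact_range (map_continuous ρ)
    have hf : (Set.range (fun σ => ρ σ)).Finite := hc.finite_of_discrete
    have hf' : ((ρ.toMonoidHom.range : Subgroup (GL (Fin 2) k)) : Set (GL (Fin 2) k)).Finite := by
      rw [MonoidHom.coe_range]
      exact hf
    exact hf'.to_subtype
  obtain ⟨g, hg⟩ :=
    hDickson k ρ.toMonoidHom.range hfin (hBound F hF h5 k ρ hirr hodd hur) hns
  exact hns (hF9 F hF h5 k ρ hirr hodd hur ⟨g, hg⟩)

/-- THE SKELETON THEOREM (registrar shape): the crux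
`Summit.Langlands.Langlands.Theses.GoldenFieldSerre.LevelOneModThreeGolden` concluded BY NAME from
the three declared stubs through the sorry-free assembly `LevelOneModThreeGolden_of_stubs`; the only
`sorry`s in its closure are `stub_imageBound`, `stub_dicksonSmall`, `stub_f9SectorSolvable`. -/
theorem LevelOneModThreeGolden_of :
    Summit.Langlands.Langlands.Theses.GoldenFieldSerre.LevelOneModThreeGolden :=
  LevelOneModThreeGolden_of_stubs stub_imageBound stub_dicksonSmall stub_f9SectorSolvable

end Summit.Langlands.Langlands.Cruxes.LevelOneModThreeGolden.Birth
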